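import Literature.AnabelianGeometry.AbsoluteAnabelian.RelativeGrothendieckConjecture
import HarnessLib

/-!
# Outer homomorphisms over `G`: inner by `Π` versus inner by `Δ` (faithfulness lemmas)

Proof-only companion to `RelativeGrothendieckConjecture.lean`.  [pGC] Thm A p. 3 takes homomorphisms
over `Γ_K` "up to composition with an inner automorphism arising from `Δ_Y`"; [Tpcs] Thm 4.12 p. 44
"up to composition with an inner automorphism arising from `Π^{(X₁)}_K` or `Π^{(X₂)}_K`" [= `Δ₁` or
`Δ₂`]; [AbsTopI] Def 4.6 (ii) p. 56 uses OUTER isomorphisms `Π₁ ≅ Π₂` (modulo all of `Inn(Π₂)`)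
lying over an outer `ζ_G`.  The typed quotient `AugmentedProfiniteGrp.OuterHom` is "modulo `Δ` of the
target"; the lemmas below PROVE that the three conventions agree: conjugating on the SOURCE by an
element of `Δ_A` stays in the same class (`innerEquiv_of_compConj`), and — when `G` is center-free, as it
is for (generalized) sub-`p`-adic base fields ([pGC] Lem 15.8 / [Tpcs] Lem 4.14) — two homomorphisms
over `G` that differ by conjugation by ANY element of `Π_B` already differ by an element of `Δ_B`
(`mem_geom_of_conj_over`, `innerEquiv_of_conj_of_center_eq_bot`).  No new definitions.
[cite: MochizukiLocAn1999, Thm A p.3]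
-/

universe u

namespace Literature.AnabelianGeometry.AbsoluteAnabelian.AugmentedProfiniteGrp

variable {G : ProfiniteGrp.{u}} {A B : AugmentedProfiniteGrp G}

namespace HomOver

/-- If `ψ = h φ h⁻¹` for homomorphisms `φ, ψ` OVER `G` and an arbitrary `h ∈ Π_B`, then `aug h`
centralizes `G` (because `aug ∘ φ = aug_A` is surjective); hence `h ∈ Δ_B` as soon as `G` is
center-free. [cite: MochizukiTopics2003, Thm 4.12 p.44] -/
theorem mem_geom_of_conj_over (hG : Subgroup.center G = ⊥) (φ ψ : HomOver A B) (h : B.arith)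
    (hconj : ∀ x, ψ.toHom x = h * φ.toHom x * h⁻¹) : h ∈ B.geom := by
  rw [mem_geom]
  have hc : B.aug h ∈ Subgroup.center G := by
    rw [Subgroup.mem_center_iff]
    intro g
    obtain ⟨x, rfl⟩ := A.aug_surjective g
    have h1 := ψ.over x
    rw [hconj x, map_mul, map_mul, map_inv, φ.over x] at h1
    -- h1 : aug h * aug_A x * (aug h)⁻¹ = aug_A x
    calc A.aug x * B.aug h = B.aug h * A.aug x * (B.aug h)⁻¹ * B.aug h := by rw [h1]
      _ = B.aug h * A.aug x := by group
  rw [hG] at hc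
  exact Subgroup.mem_bot.mp hc

/-- Over a center-free `G`, "up to an inner automorphism of `Π_B`" = "up to an inner automorphism
arising from `Δ_B`" for homomorphisms over `G`: the [AbsTopI] Def 4.6 (ii) "outer" convention and the
[pGC]/[Tpcs] "`Δ`-inner" convention give the same classes. [cite: MochizukiAbsTopI2012, Def 4.6 (ii) p.56] -/
theorem innerEquiv_of_conj_of_center_eq_bot (hG : Subgroup.center G = ⊥) (φ ψ : HomOver A B)
    (h : B.arith) (hconj : ∀ x, ψ.toHom x = h * φ.toHom x * h⁻¹) : InnerEquiv φ ψ := by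
  refine ⟨h, mem_geom_of_conj_over hG φ ψ h hconj, ?_⟩
  ext x
  simpa using hconj x

/-- A homomorphism over `G` maps `Δ_A` into `Δ_B`. [cite: MochizukiLocAn1999, Thm A p.3] -/
theorem apply_mem_geom (φ : HomOver A B) {g : A.arith} (hg : g ∈ A.geom) : φ.toHom g ∈ B.geom := by
  rw [mem_geom] at hg ⊢
  rw [φ.over, hg]

/-- Source-side `Δ_A`-conjugation does not change the class: if `ψ = φ ∘ conj(g)` with `g ∈ Δ_A`
then `ψ = conj(φ g) ∘ φ` with `φ g ∈ Δ_B` ("arising from `Π^{(X₁)}_K` OR `Π^{(X₂)}_K`", [Tpcs]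
Thm 4.12 p. 44, gives the same quotient). [cite: MochizukiTopics2003, Thm 4.12 p.44] -/
theorem innerEquiv_of_compConj (φ ψ : HomOver A B) (g : A.arith) (hg : g ∈ A.geom)
    (hψ : ∀ x, ψ.toHom x = φ.toHom (g * x * g⁻¹)) : InnerEquiv φ ψ := by
  refine ⟨φ.toHom g, φ.apply_mem_geom hg, ?_⟩
  ext x
  rw [hψ x, conj_apply, map_mul, map_mul, map_inv]

end HomOver

end Literature.AnabelianGeometry.AbsoluteAnabelian.AugmentedProfiniteGrp
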